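import Mathlib
import Literature.Algebra.Polynomial.PolyaSzegoHalfLine

/-!
# Stub `stub_polyaSzego` for the crux `BrascampLiebVacuum` (line `SketchIdeator2`)

Pólya–Szegő on the half-line, weak form: a real polynomial of degree `≤ 2S + 1` which is
non-negative on `[0, ∞)` is `Σᵢ fᵢ² + X · Σᵢ gᵢ²` with finitely many real polynomials `fᵢ, gᵢ`
of degree `≤ S`. This is `Literature.Algebra.Polynomial.polyaSzego_halfLine`
(`Literature/Algebra/Polynomial/PolyaSzegoHalfLine.lean`), restated verbatim in the shape
registered for the skeleton; it feeds `stub_momentCone` (truncated symmetric Stieltjes moment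
cone) of the thermal reflection-positivity square root.
-/

open scoped BigOperators

namespace Summit.QuantumFields.YangMills.Theorems.BrascampLiebVacuum

/-- **Stub (real algebra, M — Pólya–Szegő on the half-line, weak form).** A real polynomial of
degree `≤ 2S+1` that is non-negative on `[0, ∞)` is `Σᵢ fᵢ² + X · Σᵢ gᵢ²` with finitely many real
polynomials `fᵢ, gᵢ` of degree `≤ S` (any number of squares; Pólya–Szegő 1925 give two + two).
Proof: `Literature.Algebra.Polynomial.polyaSzego_halfLine` (`P(X²) ≥ 0` on `ℝ` is a finite sum
of squares by induction on the degree through the minimum point; even/odd split of the squares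
and comparison of even coefficients). [folklore] -/
theorem stub_polyaSzego :
    ∀ (S : ℕ) (P : Polynomial ℝ), P.natDegree ≤ 2 * S + 1 → (∀ x : ℝ, 0 ≤ x → 0 ≤ P.eval x) →
      ∃ (m : ℕ) (f g : ℕ → Polynomial ℝ), (∀ i < m, (f i).natDegree ≤ S ∧ (g i).natDegree ≤ S) ∧
        P = ∑ i ∈ Finset.range m, (f i) ^ 2 + Polynomial.X * ∑ i ∈ Finset.range m, (g i) ^ 2 :=
  fun S P h1 h2 => Literature.Algebra.Polynomial.polyaSzego_halfLine S P h1 h2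

end Summit.QuantumFields.YangMills.Theorems.BrascampLiebVacuum
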